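import Literature.IUT.LogVolume.InitialThetaDataVolume
import Summits.ABC.IUTFork.Cor312ProvenanceMod
import Summits.ABC.IUTFork.Cor312ProvenancePointJ
import HarnessLib

/-!
# [IUTchIII] Cor. 3.12 provenance — the summit-side identification of the GENUINE Θ-volume input's `−|log(q)|`
# with `−(1/2l)·log(q)` of the initial Θ-data (c312 crew, wave 2, board row W2-F′ × route D3)

Record-only companion (seat abc-iut-c312-8, gen 2); TAKES NO SIDE on Cor. 3.12. abc-iut-S2's Literature-level adapter
`Literature/IUT/LogVolume/InitialThetaDataVolume.lean` (route definition request D3 `defn-NegLogThetaAtDatum`, part d) attaches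
to a collection of initial Θ-data `D` ([IUTchI] Def. 3.1, abc-iut-L5-t2) its Dupuy–Hilado pilot data OVER THE FIELD OF MODULI,
`ThetaData.pilotData D : PilotData (fieldOfModuli E)` (`j_E`, `S = V^bad_mod`, `l`), and the predicate
`ThetaData.IsVolumeInputOf D I` for a genuine Θ-volume input `I : ThetaVolumeInput (fieldOfModuli E) K` (`GenuineLogTheta.lean`),
whose `q`-side number is `I.negAbsLogQ = −deĝ̲_{F_mod}(P_q)` — and records as "Deliberately NOT here: … the summit-side
identification `negAbsLogQ = −(1/2l)·Cor312Prov.logq D`". THIS FILE is that identification (all PROVED):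

* `ndeg_qDivisor_pilotData_eq_logq` — `deĝ̲_{F_mod}(𝔮(pilotData D)) = Cor312Prov.logq D`: the `q`-parameter degree of `D` computed
  over `F_mod` (`S = V^bad_mod`, `ord_w(q) = −ord_w(j_E)`) IS `log(q)` computed over `F` ([IUTchIV] p. 23 "independent of the choice
  of `F□`"; the `F`/`F_mod` base change `Cor312Prov.logq_eq_sum_mod`, `Cor312ProvenanceMod.lean`);
* **`negAbsLogQ_eq_neg_absLogq_of_isVolumeInputOf`** — `I.negAbsLogQ = −absLogq D` for every genuine Θ-volume input `I` OF `D`;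
  hence the `q`-sides of the route's Literature-level vocabulary (S2's D3), of the verbatim setting (`IsSettingOf.negLogQ_eq`), of
  the Dupuy–Hilado datum (`negLogQ_eq_negAbsLogqDH`) and of the `λ`-line point (`logq_eq_logQAvoid_of_j`) are ONE number;
* `negAbsLogQ_eq_neg_logQAvoid_of_isP5Choice` — with S2's `ThetaData.IsP5Choice D` (= the `F`-level (P5) reading `hV` of the point
  dictionary, verbatim) and any model `E` of the point's curve (`j(E) = j(λ)`): `I.negAbsLogQ = −(1/2l)·Cor22.logQAvoid Q {2,l}`.
* (appended) `statement_iff_cor312Of_of_links` / `cor312Of_of_statement_of_links` / `statement_of_cor312Of_of_links` — the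
  route's Literature-level `ThetaVolumeInput.Cor312Of I` (S2) vs the verbatim `P.Statement` (c312-7) for `I`, `P` attached to the
  same `D`: equal propositions under the one Θ-side identification `P.negLogTheta = ↑I.negLogTheta` (one-directional forms with `≤`).
[cite: Mochizuki2012, IUTchIV Thm. 1.10 p. 23] [cite: DupuyHilado2025, §3.3] [claim: Mochizuki2012, status: disputed] for every IUT
quotation. Nothing is asserted about any curve.
-/

noncomputable section

namespace Summit.ABC.IUTFork.Cor312Prov

open Literature.IUT.HodgeTheaters Literature.IUT.LogVolume NumberField IsDedekindDomain
open scoped Classical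

variable {F K Fbar : Type} [Field F] [NumberField F] [Field K] [NumberField K]
  [Algebra F K] [Field Fbar] [Algebra F Fbar] [Algebra K Fbar] {E : WeierstrassCurve F} [E.IsElliptic]
  {l : ℕ} {Pb : BadPlacePredicates K}

/-- **`deĝ̲_{F_mod}(𝔮(pilotData D)) = log(q)`**: the normalized degree over `F_mod` of the `q`-parameter divisor
`𝔮 = Σ_{w ∈ V^bad_mod} (−ord_w j_E)·[w]` of S2's pilot data OF `D` equals `Cor312Prov.logq D` (computed over `F` from `ord_v(Δ_min)` at
`𝕍(F)^bad`) — [IUTchIV] p. 23 "the various `log(q_{(−)})`'s are independent of the choice of `F□`" between `F□ = F_mod` and `F□ = F`.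
PROVED (`logq_eq_sum_mod` + reindexing `V^bad_mod` along `FinitePlace.maximalIdeal`). [claim: Mochizuki2012, status: disputed] -/
theorem ndeg_qDivisor_pilotData_eq_logq (D : InitialThetaData F K Fbar E l Pb) :
    FinDivisor.ndeg (fieldOfModuli E) (ThetaData.pilotData D).qDivisor = logq D := by
  rw [FinDivisor.ndeg_apply, PilotData.deg_qDivisor, ThetaData.pilotData_S,
    logq_eq_sum_mod D (ThetaData.jMod E) (ThetaData.algebraMap_jMod E)]
  congr 1
  -- `badPrimesMod D = V^bad_mod.image maximalIdeal`; the two finiteness proofs of `V^bad_mod` give the same `Finset`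
  have hT : D.VbadMod_finite.toFinset = (Thm311.Real.vbadMod_finite D).toFinset := Set.Finite.toFinset_inj.mpr rfl
  unfold ThetaData.badPrimesMod
  rw [Finset.sum_image (fun w₁ _ w₂ _ h => FinitePlace.maximalIdeal_injective h), hT]
  refine Finset.sum_congr rfl fun w _ => ?_
  unfold PilotData.ordq
  rw [ThetaData.pilotData_jE]
  push_cast
  ring

/-- **The summit-side identification S2 deferred: `I.negAbsLogQ = −absLogq D`** for every genuine Θ-volume input `I` OF the
initial Θ-data `D` (`ThetaData.IsVolumeInputOf D I`): the route's Literature-level `−|log(q)| := −deĝ̲_{F_mod}(P_q)` (S2,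
`GenuineLogTheta`) is `−(1/2l)·log(q)` of [IUTchIV] p. 23 (`Cor312Prov.absLogq D`), the number pinned on the verbatim setting by
`IsSettingOf.negLogQ_eq` and on the Dupuy–Hilado datum by `negLogQ_eq_negAbsLogqDH`. PROVED. [claim: Mochizuki2012, status: disputed] -/
theorem negAbsLogQ_eq_neg_absLogq_of_isVolumeInputOf (D : InitialThetaData F K Fbar E l Pb)
    {I : ThetaVolumeInput (fieldOfModuli E) K} (h : ThetaData.IsVolumeInputOf D I) :
    I.negAbsLogQ = -absLogq D := by
  rw [I.negAbsLogQ_eq, h.l_eq, h.X_eq, ndeg_qDivisor_pilotData_eq_logq D]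
  unfold absLogq
  ring

/-- Hence, for an input OF `D`, the Literature-level `−|log(q)|` is negative: `I.negAbsLogQ < 0` (`log(q) > 0` for every initial
Θ-datum, `Cor312Prov.absLogq_pos`; [IUTchIII] Cor. 3.12 "`|log(q)| > 0`"). PROVED. [claim: Mochizuki2012, status: disputed] -/
theorem negAbsLogQ_neg_of_isVolumeInputOf (D : InitialThetaData F K Fbar E l Pb)
    {I : ThetaVolumeInput (fieldOfModuli E) K} (h : ThetaData.IsVolumeInputOf D I) : I.negAbsLogQ < 0 := by
  rw [negAbsLogQ_eq_neg_absLogq_of_isVolumeInputOf D h, neg_lt_zero]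
  exact absLogq_pos D

/-- A genuine Θ-volume input OF `D` and a verbatim Cor. 3.12 setting attached to `D` have THE SAME `−|log(q)|`:
`I.negAbsLogQ = P.negLogQ` under `IsVolumeInputOf D I` and `IsSettingOf D P`. PROVED. [claim: Mochizuki2012, status: disputed] -/
theorem negAbsLogQ_eq_negLogQ_of_links (D : InitialThetaData F K Fbar E l Pb)
    {I : ThetaVolumeInput (fieldOfModuli E) K} (hI : ThetaData.IsVolumeInputOf D I)
    {T : Thm311.ThetaIndex} {S : Thm311.Situation T} {P : Cor312.Setting S} (hP : IsSettingOf D P) :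
    I.negAbsLogQ = P.negLogQ := by
  rw [negAbsLogQ_eq_neg_absLogq_of_isVolumeInputOf D hI, hP.negLogQ_eq]

/-! ## On the `λ`-line: with the (P5) choice, `−|log(q)| = −(1/2l)·log(q^{∤{2,l}}(λ))` -/

section Point

variable {Q : Literature.NumberTheory.DiophantineGeometry.GenEll.NFPoint} {K' Fbar' : Type} [Field K'] [NumberField K']
  [Algebra Q.F K'] [Field Fbar'] [Algebra Q.F Fbar'] [Algebra K' Fbar'] {l' : ℕ} {Pb' : BadPlacePredicates K'}
  {E' : WeierstrassCurve Q.F} [E'.IsElliptic]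

/-- **On the `λ`-line**: for an initial Θ-datum `D` over ANY model `E` of the curve of the point `Q = (F, λ)` (`j(E) = j(λ)`) with
S2's `ThetaData.IsP5Choice D` (= the point dictionary's `F`-level (P5) reading, verbatim) and a genuine Θ-volume input `I` OF `D`:
`I.negAbsLogQ = −(1/2l)·Cor22.logQAvoid Q {2, l}` — the route's Literature-level `−|log(q)|` IS minus `(1/2l)` times S-d2's
`log(q^{∤{2,l}}(λ))`. PROVED (`negAbsLogQ_eq_neg_absLogq_of_isVolumeInputOf` + `logq_eq_logQAvoid_of_j`).
[claim: Mochizuki2012, status: disputed] -/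
theorem negAbsLogQ_eq_neg_logQAvoid_of_isP5Choice (hj : E'.j = Cor22.jInv Q.x)
    (D : InitialThetaData Q.F K' Fbar' E' l' Pb') (hV : ThetaData.IsP5Choice D)
    {I : ThetaVolumeInput (fieldOfModuli E') K'} (hI : ThetaData.IsVolumeInputOf D I) :
    I.negAbsLogQ = -(Cor22.logQAvoid Q {2, l'}) / (2 * (l' : ℝ)) := by
  rw [negAbsLogQ_eq_neg_absLogq_of_isVolumeInputOf D hI]
  unfold absLogq
  rw [logq_eq_logQAvoid_of_j hj D hV]
  ring

end Point

/-! ## The Θ-side: the route's `Cor312Of I` vs the verbatim `P.Statement` (appended 2026-08-26) -/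

section Theta

variable {F K Fbar : Type} [Field F] [NumberField F] [Field K] [NumberField K]
  [Algebra F K] [Field Fbar] [Algebra F Fbar] [Algebra K Fbar] {E : WeierstrassCurve F} [E.IsElliptic]
  {l : ℕ} {Pb : BadPlacePredicates K}

/-- **The route's Literature-level Cor. 3.12 (`ThetaVolumeInput.Cor312Of I : −|log(q)| ≤ −|log(Θ)|`, S2 `GenuineLogTheta`) vs
the VERBATIM `P.Statement` (c312-7)**, for a genuine Θ-volume input `I` and a verbatim setting `P` both attached to the initial
Θ-data `D`: the `q`-sides agree by `negAbsLogQ_eq_negLogQ_of_links`; under the ONE remaining identification of the Θ-sides —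
the verbatim `−|log(Θ)| ∈ ℝ ∪ {+∞}` IS the genuine input's real number `I.negLogTheta` (`hΘ`; the content of plan's layer-2 child
(ii)/(iii) "at the assembled real setting", C312-RESIDUALS §1a′) — the two typed statements are the same proposition. PROVED;
neither side asserted. [claim: Mochizuki2012, status: disputed] -/
theorem statement_iff_cor312Of_of_links (D : InitialThetaData F K Fbar E l Pb)
    {I : ThetaVolumeInput (fieldOfModuli E) K} (hI : ThetaData.IsVolumeInputOf D I)
    {T : Thm311.ThetaIndex} {S : Thm311.Situation T} {P : Cor312.Setting S} (hP : IsSettingOf D P)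
    (hΘ : P.negLogTheta = ((I.negLogTheta : ℝ) : WithTop ℝ)) : P.Statement ↔ I.Cor312Of := by
  rw [ThetaVolumeInput.Cor312Of, Cor312.Setting.Statement, hΘ, negAbsLogQ_eq_negLogQ_of_links D hI hP]
  constructor
  · rintro ⟨-, hle⟩
    exact WithTop.coe_le_coe.mp hle
  · intro hle
    exact ⟨WithTop.coe_ne_top, WithTop.coe_le_coe.mpr hle⟩

/-- One-directional form: if the verbatim `−|log(Θ)|` is at most the genuine input's (`hΘ`), the printed statement for `P` implies
`I.Cor312Of`. PROVED. [claim: Mochizuki2012, status: disputed] -/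
theorem cor312Of_of_statement_of_links (D : InitialThetaData F K Fbar E l Pb)
    {I : ThetaVolumeInput (fieldOfModuli E) K} (hI : ThetaData.IsVolumeInputOf D I)
    {T : Thm311.ThetaIndex} {S : Thm311.Situation T} {P : Cor312.Setting S} (hP : IsSettingOf D P)
    (hΘ : P.negLogTheta ≤ ((I.negLogTheta : ℝ) : WithTop ℝ)) (h : P.Statement) : I.Cor312Of := by
  rw [ThetaVolumeInput.Cor312Of, negAbsLogQ_eq_negLogQ_of_links D hI hP]
  obtain ⟨-, hle⟩ := h
  exact WithTop.coe_le_coe.mp (hle.trans hΘ)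

/-- Converse one-directional form: if the genuine input's `−|log(Θ)|` is at most the verbatim one (`hΘ`) and the latter is finite
(`hfin`), `I.Cor312Of` implies the printed statement for `P`. PROVED. [claim: Mochizuki2012, status: disputed] -/
theorem statement_of_cor312Of_of_links (D : InitialThetaData F K Fbar E l Pb)
    {I : ThetaVolumeInput (fieldOfModuli E) K} (hI : ThetaData.IsVolumeInputOf D I)
    {T : Thm311.ThetaIndex} {S : Thm311.Situation T} {P : Cor312.Setting S} (hP : IsSettingOf D P)
    (hΘ : ((I.negLogTheta : ℝ) : WithTop ℝ) ≤ P.negLogTheta) (hfin : P.negLogTheta ≠ ⊤) (h : I.Cor312Of) :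
    P.Statement := by
  rw [ThetaVolumeInput.Cor312Of, negAbsLogQ_eq_negLogQ_of_links D hI hP] at h
  exact ⟨hfin, (WithTop.coe_le_coe.mpr h).trans hΘ⟩

end Theta

end Summit.ABC.IUTFork.Cor312Prov

end
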